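import Literature.AnabelianGeometry.EtaleTheta.FrobenioidThetaDivisorSupportAdjacency
import Literature.AnabelianGeometry.EtaleTheta.Discharge.Sec5Prop53ThetaOrbit

/-!
# [EtTh] §5, Proposition 5.3 (v)/(vi): `Aut_C(A_⊚)` acts on the chain of components through `ℤ ⋊ {±1}` — FROM the intersection theory of the chain
(GAP-LEDGER G-L2d4-4, binder (hAut): its second clause reduced to cusp-preservation + F1-Aut + hInt)

Mochizuki, *The étale theta function …*, Publ. RIMS **45** (2009)
[cite: MochizukiEtTh2009, Prop 5.3 (v)(vi) p.325–326 (PDF pp.99–100); proof p.327 (PDF p.101); §1 p.238–240 (PDF pp.12–14)].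
Seat abc-iut-L6-d1 (gen 4); proof-only, over the repaired data `DivisorSupportData'` (`FrobenioidThetaDivisorSupportR.lean`),
this lineage's criteria files (`…SupportIntersection.lean`, `…SupportAdjacency.lean`) and abc-iut-L2-d4's Prop. 5.3 assembly
(`Discharge/Sec5Prop53LabelsR.lean`, `Discharge/Sec5Prop53ThetaOrbit.lean`).

THE BINDER.  abc-iut-L2-d4's `preservesThetaDivisorOrbit_of_profile'` / `geometryOfDivisorsPreserved_of_supportData'`
(Prop. 5.3 (vi) and the six-part assembly over the repaired data) carry the hypothesis binder (hAut) of GAP-LEDGER row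
G-L2d4-4: for every `g ∈ Aut_C(A_⊚)`, (1) the induced automorphism `pullAut g` of `Φ(A_⊚)` preserves the cuspidal primes,
and (2) it acts on the labels `Prime^ncsp ⥲ ℤ` of the irreducible components affinely, `label(g·𝔭) = ε·label(𝔭) + c`,
`ε = ±1` — [EtTh] §1 pp.238–239 (PDF pp.12–13): the automorphisms act on the dual graph of the special fibre, an
infinite chain, whose automorphism group is `ℤ ⋊ {±1}`.
WHAT IS PROVED.  Clause (2) is a CONSEQUENCE of clause (1), of "`(pullAut g)^gp` preserves the principal elements"
(F1-Aut, the analogue for `g` of L2-d4's F1-Ψ binder `hP`) and of the intersection-theory binder `hInt`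
(`PrincipalIffDegreeZero`, [EtTh] §1 p.240): by this lineage's `adjacencyCriterion'_of_principalIffDegreeZero` the
printed "4 versus 5 or 6" criterion holds; the criterion is phrased in transport-invariant terms (cuspidality, supports,
linear equivalence), so ANY monoid automorphism `ψ` of `Φ(A_⊚)` preserving cusps and principal elements preserves
adjacency of components (`abs_sub_eq_one_congr_of_criterion'`, the `ψ`-generic twin of L2-d4's
`adjacency_preserved_of_criterion'`), hence acts on the labels through an automorphism of the infinite chain, which is
affine (`DivisorPrimeData.ncspLabels_affine_of_adjacency`, the `ψ`-generic twin of `preservesNcspLabels_of_adjacency`,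
via abc-iut-L2-t4-lineage's `int_equiv_affine_of_adjacency`).  Assembled: `autChain_of_principalIffDegreeZero` gives
the binder (hAut) VERBATIM from {cusp-Aut, F1-Aut, hInt}, and `geometryOfDivisorsPreserved_of_principalIffDegreeZero`
gives [EtTh] Prop. 5.3 (i)–(vi) over the repaired data MODULO {`hind` ([FrdI] Thm. 4.9), (i) (Cor. 3.8 (iii)), F1-Ψ,
F1-Aut, cusp-Aut, hInt, hdiv (Prop. 1.4 (i))} — the binders hW, hCrit, hAdj (G-L2d4-2) and (hAut).2 (G-L2d4-4) being
theorems now.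
HONEST FRAMING: implications between predicates on OUR typed data; none of the remaining binders is discharged here
(owner: the genuine special fibre of `Ÿ`); typed ≠ proved for the genuine curve; no side taken on anything downstream;
nothing here lies inside the [IUTchIII] Cor. 3.12 cone. -/

namespace Literature.AnabelianGeometry.EtaleTheta

open CategoryTheory
open Literature.AlgebraicGeometry.Frobenioids

universe w v v' u u'

namespace FrobenioidThetaDivisors

open scoped Classical

variable {C : Type u} [Category.{v} C] {D : Type u'} [Category.{v'} D] {𝔉 : ThetaFrobenioid.{w} C D}
variable {𝔓 : DivisorPrimeData 𝔉}

/-! ### The rigidity of the chain, for an arbitrary cusp-preserving automorphism of `Φ(A_⊚)` -/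

/-- **A cusp-preserving monoid automorphism `ψ` of `Φ(A_⊚)` that preserves adjacency of components acts on the labels
`Prime^ncsp ⥲ ℤ` affinely**, `label(ψ𝔭) = ε·label(𝔭) + c` with `ε = ±1` (the `ψ`-generic form of
`preservesNcspLabels_of_adjacency`; the automorphism group of the infinite chain is `ℤ ⋊ {±1}`).
[cite: MochizukiEtTh2009, Prop 5.3 (v) p.325 (PDF p.99); proof p.327 (PDF p.101); §1 p.238–239 (PDF pp.12–13)] -/
theorem DivisorPrimeData.ncspLabels_affine_of_adjacency (𝔓 : DivisorPrimeData 𝔉) (ψ : 𝔉.PhiAcirc ≃* 𝔉.PhiAcirc)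
    (hc : ∀ 𝔭, 𝔓.IsCuspidal (Primes.congr ψ 𝔭) ↔ 𝔓.IsCuspidal 𝔭)
    (hadj : ∀ (p q : Primes 𝔉.PhiAcirc) (hp : ¬ 𝔓.IsCuspidal p) (hq : ¬ 𝔓.IsCuspidal q),
      |𝔓.ncspEquivZ ⟨p, hp⟩ - 𝔓.ncspEquivZ ⟨q, hq⟩| = 1 →
        |𝔓.ncspEquivZ ⟨Primes.congr ψ p, fun h => hp ((hc p).mp h)⟩ -
          𝔓.ncspEquivZ ⟨Primes.congr ψ q, fun h => hq ((hc q).mp h)⟩| = 1) :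
    ∃ (ε : ℤˣ) (c : ℤ), ∀ (p : Primes 𝔉.PhiAcirc) (hp : ¬ 𝔓.IsCuspidal p),
      𝔓.ncspEquivZ ⟨Primes.congr ψ p, fun h => hp ((hc p).mp h)⟩ = (ε : ℤ) * 𝔓.ncspEquivZ ⟨p, hp⟩ + c := by
  -- `ψ` on the non-cuspidal primes, as a bijection, read on the labels
  let τ : {p : Primes 𝔉.PhiAcirc // ¬ 𝔓.IsCuspidal p} ≃ {p : Primes 𝔉.PhiAcirc // ¬ 𝔓.IsCuspidal p} :=
    (Primes.congr ψ).subtypeEquiv fun p => not_congr (hc p).symm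
  let σ : ℤ ≃ ℤ := (𝔓.ncspEquivZ.symm.trans τ).trans 𝔓.ncspEquivZ
  have hσ : ∀ i j : ℤ, |i - j| = 1 → |σ i - σ j| = 1 := by
    intro i j hij
    have := hadj (𝔓.ncspEquivZ.symm i) (𝔓.ncspEquivZ.symm j) (𝔓.ncspEquivZ.symm i).2
      (𝔓.ncspEquivZ.symm j).2
    simp only [Subtype.coe_eta, Equiv.apply_symm_apply] at this
    exact this hij
  obtain ⟨ε, c, hεc⟩ := int_equiv_affine_of_adjacency σ hσ
  refine ⟨ε, c, fun p hp => ?_⟩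
  have := hεc (𝔓.ncspEquivZ ⟨p, hp⟩)
  simp only [σ, τ, Equiv.trans_apply, Equiv.symm_apply_apply, Equiv.subtypeEquiv_apply] at this
  exact this

namespace DivisorSupportData'

variable (𝔖 : DivisorSupportData' 𝔓) (ψ : 𝔉.PhiAcirc ≃* 𝔉.PhiAcirc)

/-- **Adjacency of components is preserved by ANY monoid automorphism `ψ` of `Φ(A_⊚)` preserving the cuspidal primes
and the principal elements**, given the printed criterion `AdjacencyCriterion'` ("adjacent iff every cuspidally minimal
`c` linearly equivalent to `a + b` has support of cardinality `4`", pp.326–327 — a sentence in transport-invariant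
terms).  The `ψ`-generic form of abc-iut-L2-d4's `adjacency_preserved_of_criterion'` (same proof).
[cite: MochizukiEtTh2009, Prop 5.3 proof p.327 (PDF p.101)] -/
theorem abs_sub_eq_one_congr_of_criterion'
    (hc : ∀ 𝔭, 𝔓.IsCuspidal (Primes.congr ψ 𝔭) ↔ 𝔓.IsCuspidal 𝔭)
    (hP : ∀ x, ThetaFrobenioid.gpMap ψ.toMonoidHom x ∈ 𝔖.principal ↔ x ∈ 𝔖.principal)
    (hAdj : AdjacencyCriterion' 𝔖) (𝔭 𝔮 : Primes 𝔉.PhiAcirc) (h𝔭 : ¬ 𝔓.IsCuspidal 𝔭) (h𝔮 : ¬ 𝔓.IsCuspidal 𝔮)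
    (hadj : |𝔓.ncspEquivZ ⟨𝔭, h𝔭⟩ - 𝔓.ncspEquivZ ⟨𝔮, h𝔮⟩| = 1) :
    |𝔓.ncspEquivZ ⟨Primes.congr ψ 𝔭, fun h => h𝔭 ((hc 𝔭).mp h)⟩ -
        𝔓.ncspEquivZ ⟨Primes.congr ψ 𝔮, fun h => h𝔮 ((hc 𝔮).mp h)⟩| = 1 := by
  have hne : 𝔭 ≠ 𝔮 := by
    rintro rfl
    rw [sub_self, abs_zero] at hadj
    exact zero_ne_one hadj
  have h𝔭' : ¬ 𝔓.IsCuspidal (Primes.congr ψ 𝔭) := fun h => h𝔭 ((hc 𝔭).mp h)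
  have h𝔮' : ¬ 𝔓.IsCuspidal (Primes.congr ψ 𝔮) := fun h => h𝔮 ((hc 𝔮).mp h)
  have hne' : Primes.congr ψ 𝔭 ≠ Primes.congr ψ 𝔮 := fun h => hne ((Primes.congr ψ).injective h)
  let a : 𝔭.submonoid := ⟨𝔖.gen 𝔭, Submonoid.subset_closure (𝔖.gen_mem_carrier' 𝔭)⟩
  have ha : (a : 𝔉.PhiAcirc) ∈ 𝔭.carrier := 𝔖.gen_mem_carrier' 𝔭
  have H4 := (hAdj 𝔭 𝔮 h𝔭 h𝔮 hne a ha).1.mp hadj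
  let a' : (Primes.congr ψ 𝔭).submonoid := Primes.submonoidCongr ψ 𝔭 _ rfl a
  have ha' : (a' : 𝔉.PhiAcirc) ∈ (Primes.congr ψ 𝔭).carrier := by
    rw [Primes.coe_submonoidCongr_apply, Primes.carrier_congr]
    exact ⟨_, ha, rfl⟩
  have hb' : (𝔓.ncspIso _ _ h𝔭' h𝔮' a' : 𝔉.PhiAcirc) = ψ (𝔓.ncspIso 𝔭 𝔮 h𝔭 h𝔮 a : 𝔉.PhiAcirc) :=
    (apply_componentIso_eq ψ 𝔖.monoidTypeZ' 𝔭 𝔮 (𝔓.ncspIso 𝔭 𝔮 h𝔭 h𝔮) (𝔓.ncspIso _ _ h𝔭' h𝔮') a).symm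
  refine (hAdj _ _ h𝔭' h𝔮' hne' a' ha').1.mpr fun c' hc' hlin => ?_
  have hcc : ThetaFrobenioid.gpMap ψ.toMonoidHom (ThetaFrobenioid.gpMap ψ.symm.toMonoidHom c') = c' :=
    DivisorSupportData.gpMap_gpMap_symm ψ c'
  rw [← hcc] at hc' hlin ⊢
  change (suppOf' 𝔖.factor _).ncard = 4
  rw [𝔖.ncard_supp_gpMap']
  refine H4 _ ((𝔖.isCuspidallyMinimal_gpMap_iff' ψ hc hP _).mp hc') ?_
  have hab : Algebra.GrothendieckGroup.of (a' : 𝔉.PhiAcirc) *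
      Algebra.GrothendieckGroup.of (𝔓.ncspIso _ _ h𝔭' h𝔮' a' : 𝔉.PhiAcirc) =
      ThetaFrobenioid.gpMap ψ.toMonoidHom (Algebra.GrothendieckGroup.of (a : 𝔉.PhiAcirc) *
        Algebra.GrothendieckGroup.of (𝔓.ncspIso 𝔭 𝔮 h𝔭 h𝔮 a : 𝔉.PhiAcirc)) := by
    rw [map_mul, ThetaFrobenioid.gpMap_of, ThetaFrobenioid.gpMap_of, hb', Primes.coe_submonoidCongr_apply,
      MulEquiv.coe_toMonoidHom]
  rw [hab] at hlin
  exact (𝔖.linEquiv_gpMap_iff' ψ hP _ _).mp hlin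

/-- **Labels are transported affinely by ANY monoid automorphism of `Φ(A_⊚)` preserving cusps and principal elements**,
under the intersection-theory binder `hInt` (`PrincipalIffDegreeZero`, [EtTh] §1 p.240): the adjacency criterion holds
by `adjacencyCriterion'_of_principalIffDegreeZero`, adjacency is transported, and the chain is rigid.
[cite: MochizukiEtTh2009, Prop 5.3 (v) p.325 (PDF p.99); proof p.327 (PDF p.101); §1 p.240 (PDF p.14)] -/
theorem ncspLabels_affine_of_principalIffDegreeZero (hI : 𝔖.PrincipalIffDegreeZero)
    (hc : ∀ 𝔭, 𝔓.IsCuspidal (Primes.congr ψ 𝔭) ↔ 𝔓.IsCuspidal 𝔭)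
    (hP : ∀ x, ThetaFrobenioid.gpMap ψ.toMonoidHom x ∈ 𝔖.principal ↔ x ∈ 𝔖.principal) :
    ∃ (ε : ℤˣ) (c : ℤ), ∀ (p : Primes 𝔉.PhiAcirc) (hp : ¬ 𝔓.IsCuspidal p),
      𝔓.ncspEquivZ ⟨Primes.congr ψ p, fun h => hp ((hc p).mp h)⟩ = (ε : ℤ) * 𝔓.ncspEquivZ ⟨p, hp⟩ + c :=
  𝔓.ncspLabels_affine_of_adjacency ψ hc fun p q hp hq h =>
    𝔖.abs_sub_eq_one_congr_of_criterion' ψ hc hP (𝔖.adjacencyCriterion'_of_principalIffDegreeZero hI) p q hp hq h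

/-! ### The binder (hAut) of G-L2d4-4, from cusp-Aut + F1-Aut + hInt -/

/-- **The binder (hAut) of `preservesThetaDivisorOrbit_of_profile'`, VERBATIM, from the intersection theory of the
chain**: if every `g ∈ Aut_C(A_⊚)` preserves the cuspidal primes (`hAc`) and the principal elements (`hAP`, F1-Aut),
then under `PrincipalIffDegreeZero` every `g` acts on the labels of the components through `ℤ ⋊ {±1}` — "the
automorphisms … act on the dual graph of the special fibre [an infinite chain]" (§1 pp.238–239).
[cite: MochizukiEtTh2009, §1 p.238–240 (PDF pp.12–14); Prop 5.3 (vi) p.326 (PDF p.100); proof p.327 (PDF p.101)] -/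
theorem autChain_of_principalIffDegreeZero (hI : 𝔖.PrincipalIffDegreeZero)
    (hAc : ∀ (g : Aut 𝔉.Acirc) (𝔭 : Primes 𝔉.PhiAcirc),
      𝔓.IsCuspidal (Primes.congr (𝔉.pullAut g) 𝔭) ↔ 𝔓.IsCuspidal 𝔭)
    (hAP : ∀ (g : Aut 𝔉.Acirc) (x : Algebra.GrothendieckGroup 𝔉.PhiAcirc),
      ThetaFrobenioid.gpMap (𝔉.pullAut g).toMonoidHom x ∈ 𝔖.principal ↔ x ∈ 𝔖.principal) :
    ∀ g : Aut 𝔉.Acirc, (∀ 𝔭, 𝔓.IsCuspidal (Primes.congr (𝔉.pullAut g) 𝔭) ↔ 𝔓.IsCuspidal 𝔭) ∧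
      ∃ (ε : ℤˣ) (c : ℤ), ∀ (𝔭 : Primes 𝔉.PhiAcirc) (h𝔭 : ¬ 𝔓.IsCuspidal 𝔭)
        (h𝔭' : ¬ 𝔓.IsCuspidal (Primes.congr (𝔉.pullAut g) 𝔭)),
        𝔓.ncspEquivZ ⟨Primes.congr (𝔉.pullAut g) 𝔭, h𝔭'⟩ = ε * 𝔓.ncspEquivZ ⟨𝔭, h𝔭⟩ + c := by
  intro g
  obtain ⟨ε, c, h⟩ := 𝔖.ncspLabels_affine_of_principalIffDegreeZero (𝔉.pullAut g) hI (hAc g) (hAP g)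
  exact ⟨hAc g, ε, c, fun 𝔭 h𝔭 _ => h 𝔭 h𝔭⟩

/-! ### [EtTh] Proposition 5.3, all six parts, modulo the structural binders only -/

section Prop53

variable (Ψ : C ≌ C) (ι : Ψ.functor.obj 𝔉.Acirc ≅ 𝔉.Acirc)
  (e : 𝔉.PhiAcirc ≃* 𝔉.pre.Mon (𝔉.base.obj (Ψ.functor.obj 𝔉.Acirc)))

/-- **[EtTh] Proposition 5.3 (i)–(vi) over the repaired data, from the intersection theory of the chain**: abc-iut-L2-d4's
six-part assembly `geometryOfDivisorsPreserved_of_supportData'` with its binders hW, hCrit, hAdj (the printed criteria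
of the proof, G-L2d4-2) and (hAut).2 (G-L2d4-4) DISCHARGED by this lineage — what remains is {`hind` (the `Ψ`-induced
isomorphism of divisor monoids, [FrdI] Thm. 4.9), (i) as typed (Cor. 3.8 (iii)), F1-Ψ (`hP`), F1-Aut (`hAP`), cusp-Aut
(`hAc`), the intersection-theory binder `hInt` ([EtTh] §1 p.240) and the profile of `div(Θ̈)` (`hdiv`, Prop. 1.4 (i))}.
[cite: MochizukiEtTh2009, Prop 5.3 p.325–326 (PDF pp.99–100); proof p.326–327 (PDF pp.100–101); §1 p.240 (PDF p.14); Prop 1.4 (i) p.247 (PDF p.21)] -/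
theorem geometryOfDivisorsPreserved_of_principalIffDegreeZero (T : DivisorTransportStub 𝔉)
    (hind : T.IsInducedBy Ψ 𝔉.Acirc e) (hi : PreservesCuspidality T 𝔓 Ψ ι e)
    (hP : ∀ x, ThetaFrobenioid.gpMap (psiPhi 𝔉 Ψ ι e).toMonoidHom x ∈ 𝔖.principal ↔ x ∈ 𝔖.principal)
    (hI : 𝔖.PrincipalIffDegreeZero)
    (θ : ℤ → ℚ) (s : ℤ) (hθ : ∀ j, θ (s - j) = θ j)
    (hdiv : ∀ (𝔫 : Primes 𝔉.PhiAcirc) (h𝔫 : ¬ 𝔓.IsCuspidal 𝔫),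
      𝔖.ord 𝔫 𝔓.divTheta = θ (𝔓.ncspEquivZ ⟨𝔫, h𝔫⟩))
    (hAc : ∀ (g : Aut 𝔉.Acirc) (𝔭 : Primes 𝔉.PhiAcirc),
      𝔓.IsCuspidal (Primes.congr (𝔉.pullAut g) 𝔭) ↔ 𝔓.IsCuspidal 𝔭)
    (hAP : ∀ (g : Aut 𝔉.Acirc) (x : Algebra.GrothendieckGroup 𝔉.PhiAcirc),
      ThetaFrobenioid.gpMap (𝔉.pullAut g).toMonoidHom x ∈ 𝔖.principal ↔ x ∈ 𝔖.principal) :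
    GeometryOfDivisorsPreserved T 𝔓 Ψ ι e :=
  geometryOfDivisorsPreserved_of_supportData' Ψ ι e T 𝔖 hind hi hP
    (𝔖.cspToNcspWitnessed'_of_principalIffDegreeZero hI)
    (𝔖.cspToNcspCriterion'_of_degree fun x hx => (hI x).mp hx)
    (𝔖.adjacencyCriterion'_of_principalIffDegreeZero hI) θ s hθ hdiv
    (𝔖.autChain_of_principalIffDegreeZero hI hAc hAP)

/-- **[EtTh] Proposition 5.3 (vi) over the repaired data, from the intersection theory of the chain**: the
`Aut_C(A_⊚)`-orbit of `div(Θ̈)` is preserved by `Ψ^Φ_{A_⊚}`, modulo {(i) on primes, F1-Ψ, F1-Aut, cusp-Aut, hInt, hdiv}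
(L2-d4's `preservesThetaDivisorOrbit_of_profile'` with (v) and (hAut) supplied).
[cite: MochizukiEtTh2009, Prop 5.3 (vi) p.326 (PDF p.100); proof p.327 (PDF p.101); Prop 1.4 (i) p.247 (PDF p.21)] -/
theorem preservesThetaDivisorOrbit_of_principalIffDegreeZero (hc : CuspPreserved 𝔓 Ψ ι e)
    (hP : ∀ x, ThetaFrobenioid.gpMap (psiPhi 𝔉 Ψ ι e).toMonoidHom x ∈ 𝔖.principal ↔ x ∈ 𝔖.principal)
    (hI : 𝔖.PrincipalIffDegreeZero)
    (θ : ℤ → ℚ) (s : ℤ) (hθ : ∀ j, θ (s - j) = θ j)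
    (hdiv : ∀ (𝔫 : Primes 𝔉.PhiAcirc) (h𝔫 : ¬ 𝔓.IsCuspidal 𝔫),
      𝔖.ord 𝔫 𝔓.divTheta = θ (𝔓.ncspEquivZ ⟨𝔫, h𝔫⟩))
    (hAc : ∀ (g : Aut 𝔉.Acirc) (𝔭 : Primes 𝔉.PhiAcirc),
      𝔓.IsCuspidal (Primes.congr (𝔉.pullAut g) 𝔭) ↔ 𝔓.IsCuspidal 𝔭)
    (hAP : ∀ (g : Aut 𝔉.Acirc) (x : Algebra.GrothendieckGroup 𝔉.PhiAcirc),
      ThetaFrobenioid.gpMap (𝔉.pullAut g).toMonoidHom x ∈ 𝔖.principal ↔ x ∈ 𝔖.principal) :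
    PreservesThetaDivisorOrbit 𝔓 Ψ ι e :=
  preservesThetaDivisorOrbit_of_profile' Ψ ι e 𝔖 hc
    (preservesNcspLabels_of_supportData' Ψ ι e 𝔖 hc hP (𝔖.adjacencyCriterion'_of_principalIffDegreeZero hI))
    θ s hθ hdiv (𝔖.autChain_of_principalIffDegreeZero hI hAc hAP)

end Prop53

end DivisorSupportData'

end FrobenioidThetaDivisors

end Literature.AnabelianGeometry.EtaleTheta
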